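import Mathlib
import HarnessLib
import Summits.HubbardSuperconductivity.HubbardSuperconductivity.Theorems.KLProgrammeC4aPartnerBandTangencyDefect

/-!
# Route `KLProgramme` — crux C4a, S3 brick (B2, TANGENCY, ph twin): the anisotropy defect of the co-moving ph loop near the `2k_F` configuration `(ρ,ϑ) = (0,π)` is
# `O(φ² + |e| + |ρ| + |ϑ − π|)`, uniformly in the base angle

Cell `gate-hubbard-kl`, lane hubbard-kl-c4a-1 (g6); helper for stub (C) `stub_twoLeg_curvature` of the engine-flow child `KLRegimeEngineV17F2`
(stmt-HubbardSuperconductivity-20437); memo HOME/hubbard-kl-c4a-1/C4A-PLAN.md §24.4 (ii), §24.6 (B2 near (T)).  Twin of `…C4aPartnerBandTangencyDefect` for the ph-crossed bubble: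
the transfer `D(t) = pairDiffPath μ K ρ ϑ θ t` reaches `2·FS` at `ϑ = π` (`D = Φ(0,θ+t) + Φ(0,θ+t)`, `pairDiffPath_tangency`), and the partner `e_K(Φ(e,φ+θ+t) − D(t))` of the
loop is, by evenness of `e_K` (`frameLevel_neg`), the pp tangency partner read at `−(2Γ − Γ(φ+·))`.  Near `(0,π)`: `D_{0,π} − D_{ρ,ϑ} = pairSumPath μ K ρ ϑ θ`, so g5's Cooper
rigidity (`norm_pairSumPath_zero_le`, `norm_deriv_pairSumPath_le_rigid`) supplies the `|ρ| + |ϑ − π|` control.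

* `hasDerivAt_pairDiffPath_zero`, `pairDiffPath_pi_sub_eq_pairSumPath`;
* **`abs_deriv_partnerBand_ph_tangency_le`** — `|∂_t|₀ e_K(Φ(e,φ+θ+t) − D(t))| ≤ C_T(φ)·φ² + (3K₂D₁/d + K₁RR₁)·(|e| + |ρ|) + (3K₂D₁² + K₁D₂)·|ϑ − π|`.

Pure calculus on landed objects; nothing about the model's sizes; nothing asserts superconductivity.  References: FST II CPAM 51 (1998) §3; BGM 2006 §2.4 (2.40) [cite: BenfattoGiulianiMastropietro2006].
-/

noncomputable section

namespace Summit.HubbardSuperconductivity.HubbardSuperconductivity.Theorems.C4a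

set_option linter.dupNamespace false -- summit = problem name (single-conjunct summit), D-0017

open Real Set Filter
open scoped Topology
open Literature.MathematicalPhysics.QuantumLattice Literature.MathematicalPhysics.QuantumLattice.BandSectorCounting Literature.Probability.LatticeModels
open Summit.HubbardSuperconductivity.HubbardSuperconductivity.Theorems.KLRegimeSplit
open Summit.HubbardSuperconductivity.HubbardSuperconductivity.Theorems.DispersionFlow
open Summit.HubbardSuperconductivity.HubbardSuperconductivity.Theorems.PerturbedFermiCurve

/-- Near the ph tangency configuration the transfer defect is the pair-SUM path: `D_{0,π}(t) − D_{ρ,ϑ}(t) = Φ(0,θ+t) + Φ(ρ,ϑ+θ+t)` (`Φ(0,s+π) = −Φ(0,s)`). -/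
theorem pairDiffPath_pi_sub_eq_pairSumPath (μ : ℝ) (K : TrigPolyC4v) (ρ ϑ θ t : ℝ) :
    pairDiffPath μ K 0 π θ t - pairDiffPath μ K ρ ϑ θ t = pairSumPath μ K ρ ϑ θ t := by
  simp only [pairDiffPath, pairSumPath]
  rw [show π + θ + t = (θ + t) + π by ring, levelPoint_add_pi]
  abel

section Sizes

variable {K : TrigPolyC4v} {A : ℝ} (hA : ∀ p : Momentum, ∀ j ≤ 2, ‖iteratedFDeriv ℝ j (frameShift K) p‖ ≤ A) (hA20 : A ≤ 1 / 20)
  (hd : klCurveD ≤ (bandBounds (show (-4 : ℝ) < -1.1 by norm_num) (show (-1.1 : ℝ) ≤ -0.1 by norm_num)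
    (show (-0.1 : ℝ) < 0 by norm_num)).Dtmin - 2 * A)
  {μ r : ℝ} (hr : 0 < r) (hlo : (-1.1 : ℝ) < μ - r - A) (hhi : μ + r + A < -0.1)
  {A₃ A₄ : ℝ} (hA₃ : ∀ p : Momentum, ‖iteratedFDeriv ℝ 3 (frameShift K) p‖ ≤ A₃)
  (hA₄ : ∀ p : Momentum, ‖iteratedFDeriv ℝ 4 (frameShift K) p‖ ≤ A₄)
  {K₁ K₂ K₃ : ℝ} (hK₁ : ∀ p : Momentum, ‖fderiv ℝ (frameLevel μ K) p‖ ≤ K₁) (hK₂ : ∀ p : Momentum, ‖iteratedFDeriv ℝ 2 (frameLevel μ K) p‖ ≤ K₂)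
  (hK₃ : ∀ p : Momentum, ‖iteratedFDeriv ℝ 3 (frameLevel μ K) p‖ ≤ K₃)
include hA hA20 hd hr hlo hhi hA₃ hA₄ hK₁ hK₂ hK₃

omit hA20 hA₃ hA₄ hK₁ hK₂ hK₃ in
/-- The t-derivative of the pair-difference path at `t = 0`: `D′(0) = ∂_sΦ(0,θ) − ∂_sΦ(ρ,ϑ+θ)`. -/
theorem hasDerivAt_pairDiffPath_zero {ρ : ℝ} (hρ : |ρ| < r) (ϑ θ : ℝ) :
    HasDerivAt (pairDiffPath μ K ρ ϑ θ) (iteratedDeriv 1 (levelPoint μ K 0) θ - iteratedDeriv 1 (levelPoint μ K ρ) (ϑ + θ)) 0 := by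
  have h0 : |(0 : ℝ)| < r := by simpa using hr
  have h1 : HasDerivAt (fun t : ℝ => levelPoint μ K 0 (θ + t)) (iteratedDeriv 1 (levelPoint μ K 0) θ) 0 :=
    HasDerivAt.comp_const_add θ 0 (by rw [add_zero]; exact hasDerivAt_levelPoint_angle hA hd hlo hhi h0 θ)
  have h2 : HasDerivAt (fun t : ℝ => levelPoint μ K ρ (ϑ + θ + t)) (iteratedDeriv 1 (levelPoint μ K ρ) (ϑ + θ)) 0 :=
    HasDerivAt.comp_const_add (ϑ + θ) 0 (by rw [add_zero]; exact hasDerivAt_levelPoint_angle hA hd hlo hhi hρ (ϑ + θ))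
  exact h1.sub h2

/-- **THE ANISOTROPY DEFECT OF THE ph LOOP NEAR `2k_F`**: for every loop level `|e| < r`, loop angle `φ`, and configuration `|ρ| < r`, `ϑ`,
`|∂_t|₀ e_K(Φ(e, φ+θ+t) − D(t))| ≤ C_T(φ)·φ² + (3K₂D₁/d + K₁RR₁)·(|e| + |ρ|) + (3K₂D₁² + K₁D₂)·|ϑ − π|`. -/
theorem abs_deriv_partnerBand_ph_tangency_le {ρ : ℝ} (hρ : |ρ| < r) {e : ℝ} (he : |e| < r) (ϑ θ φ : ℝ) :
    |deriv (fun t : ℝ => frameLevel μ K (levelPoint μ K e (φ + θ + t) - pairDiffPath μ K ρ ϑ θ t)) 0| ≤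
      (K₃ * msD A₃ A₄ 1 ^ 2 * (msD A₃ A₄ 1 + |φ| * msD A₃ A₄ 2) + K₂ * msD A₃ A₄ 2 * (3 * msD A₃ A₄ 1 + |φ| * msD A₃ A₄ 2) + K₁ * msD A₃ A₄ 3) * φ ^ 2 +
        (3 * K₂ * msD A₃ A₄ 1 / ((bandBounds (show (-4 : ℝ) < -1.1 by norm_num) (show (-1.1 : ℝ) ≤ -0.1 by norm_num) (show (-0.1 : ℝ) < 0 by norm_num)).Dtmin - 2 * A) +
          K₁ * radialRowOneConst A ((bandBounds (show (-4 : ℝ) < -1.1 by norm_num) (show (-1.1 : ℝ) ≤ -0.1 by norm_num) (show (-0.1 : ℝ) < 0 by norm_num)).Dtmin -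
            2 * A)) * (|e| + |ρ|) +
        (3 * K₂ * msD A₃ A₄ 1 ^ 2 + K₁ * msD A₃ A₄ 2) * |ϑ - π| := by
  set B₀ := bandBounds (show (-4 : ℝ) < -1.1 by norm_num) (show (-1.1 : ℝ) ≤ -0.1 by norm_num) (show (-0.1 : ℝ) < 0 by norm_num) with hB₀
  set dd := B₀.Dtmin - 2 * A with hdd
  have hADt : 2 * A < B₀.Dtmin := by have := klCurveD_pos; linarith
  have hdpos : 0 < dd := by rw [hdd]; linarith
  have h0 : |(0 : ℝ)| < r := by simpa using hr
  have hK₁0 : 0 ≤ K₁ := (norm_nonneg _).trans (hK₁ 0)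
  have hK₂0 : 0 ≤ K₂ := (norm_nonneg _).trans (hK₂ 0)
  have hf : ContDiff ℝ 4 (frameLevel μ K) := EngineV8.contDiff_frameLevel μ K
  have hf2 : ContDiff ℝ 2 (frameLevel μ K) := hf.of_le (by norm_num)
  -- curve data
  have hC : ∀ {x : ℝ}, |x| < r → ContDiff ℝ 4 (levelPoint μ K x) := fun hx => contDiff_levelPoint_angle B₀ hA hADt hlo hhi hx
  have hD : ∀ {x : ℝ}, |x| < r → ∀ {j : ℕ}, 1 ≤ j → j ≤ 4 → ∀ s, ‖iteratedDeriv j (levelPoint μ K x) s‖ ≤ msD A₃ A₄ j := fun hx _ hj1 hj4 s =>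
    norm_iteratedDeriv_levelPoint_le hA hA20 hd hlo hhi hA₃ hA₄ hx hj1 hj4 s
  have hD₁0 : 0 ≤ msD A₃ A₄ 1 := (norm_nonneg _).trans (hD h0 le_rfl (by norm_num) 0)
  have hshiftd : ∀ {x : ℝ} (hx : |x| < r) (α : ℝ), HasDerivAt (fun t : ℝ => levelPoint μ K x (α + t)) (iteratedDeriv 1 (levelPoint μ K x) α) 0 := fun hx α =>
    HasDerivAt.comp_const_add α 0 (by rw [add_zero]; exact hasDerivAt_levelPoint_angle hA hd hlo hhi hx α)
  have hDp : ∀ {x : ℝ} (hx : |x| < r) (η : ℝ), HasDerivAt (pairDiffPath μ K x η θ)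
      (iteratedDeriv 1 (levelPoint μ K 0) θ - iteratedDeriv 1 (levelPoint μ K x) (η + θ)) 0 := fun hx η => hasDerivAt_pairDiffPath_zero hA hd hr hlo hhi hx η θ
  -- the norm of `X′(0)` for `X = Φ(y, φ+θ+·) − D_{x,η}`: at most `3 D₁`
  have hXd : ∀ {x y : ℝ} (hx : |x| < r) (hy : |y| < r) (η : ℝ),
      ‖deriv (fun t : ℝ => levelPoint μ K y (φ + θ + t) - pairDiffPath μ K x η θ t) 0‖ ≤ 3 * msD A₃ A₄ 1 := fun {x y} hx hy η => by
    have hXh : HasDerivAt (fun t : ℝ => levelPoint μ K y (φ + θ + t) - pairDiffPath μ K x η θ t)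
        (iteratedDeriv 1 (levelPoint μ K y) (φ + θ) - (iteratedDeriv 1 (levelPoint μ K 0) θ - iteratedDeriv 1 (levelPoint μ K x) (η + θ))) 0 :=
      (hshiftd hy (φ + θ)).sub (hDp hx η)
    rw [hXh.deriv]
    refine (norm_sub_le _ _).trans ?_
    have := norm_sub_le (iteratedDeriv 1 (levelPoint μ K 0) θ) (iteratedDeriv 1 (levelPoint μ K x) (η + θ))
    have := hD h0 le_rfl (by norm_num) θ; have := hD hx le_rfl (by norm_num) (η + θ); have := hD hy le_rfl (by norm_num) (φ + θ)
    linarith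
  have hXdiff : ∀ {x y : ℝ} (hx : |x| < r) (hy : |y| < r) (η : ℝ), DifferentiableAt ℝ (fun t : ℝ => levelPoint μ K y (φ + θ + t) - pairDiffPath μ K x η θ t) 0 :=
    fun hx hy η => ((hshiftd hy (φ + θ)).sub (hDp hx η)).differentiableAt
  -- STEP 1: the loop level `e → 0`
  have step1 : |deriv (fun t : ℝ => frameLevel μ K (levelPoint μ K e (φ + θ + t) - pairDiffPath μ K ρ ϑ θ t)) 0 -
      deriv (fun t : ℝ => frameLevel μ K (levelPoint μ K 0 (φ + θ + t) - pairDiffPath μ K ρ ϑ θ t)) 0| ≤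
      K₂ * (|e| / dd) * (3 * msD A₃ A₄ 1) + K₁ * (radialRowOneConst A dd * |e|) := by
    have hΔd : HasDerivAt (fun t : ℝ => levelPoint μ K e (φ + θ + t) - levelPoint μ K 0 (φ + θ + t))
        (iteratedDeriv 1 (levelPoint μ K e) (φ + θ) - iteratedDeriv 1 (levelPoint μ K 0) (φ + θ)) 0 := (hshiftd he (φ + θ)).sub (hshiftd h0 (φ + θ))
    have hfun : (fun t : ℝ => frameLevel μ K (levelPoint μ K e (φ + θ + t) - pairDiffPath μ K ρ ϑ θ t)) = fun t : ℝ =>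
        frameLevel μ K ((fun s : ℝ => levelPoint μ K 0 (φ + θ + s) - pairDiffPath μ K ρ ϑ θ s) t +
          (fun s : ℝ => levelPoint μ K e (φ + θ + s) - levelPoint μ K 0 (φ + θ + s)) t) := by
      funext t; beta_reduce; congr 1; abel
    rw [hfun]
    refine (abs_deriv_comp_add_sub_le hf2 hK₁ hK₂ (hXdiff hρ h0 ϑ) hΔd.differentiableAt).trans ?_
    have hΔ0 : ‖levelPoint μ K e (φ + θ + 0) - levelPoint μ K 0 (φ + θ + 0)‖ ≤ |e| / dd := by
      have h := norm_levelPoint_sub_levelPoint_le B₀ hA hADt hlo hhi (ρ := e) (ρ' := 0) ⟨(abs_lt.1 he).1, (abs_lt.1 he).2⟩ ⟨by linarith, hr⟩ (φ + θ + 0)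
      rwa [sub_zero] at h
    have hΔ1 : ‖deriv (fun s : ℝ => levelPoint μ K e (φ + θ + s) - levelPoint μ K 0 (φ + θ + s)) 0‖ ≤ radialRowOneConst A dd * |e| := by
      rw [hΔd.deriv]
      exact norm_iteratedDeriv_one_levelPoint_sub_le hA hd hr hlo hhi he (φ + θ)
    have hX1 := hXd hρ h0 ϑ
    have hP0 : 0 ≤ K₂ * (|e| / dd) := mul_nonneg hK₂0 (div_nonneg (abs_nonneg e) hdpos.le)
    gcongr
  -- STEP 2: the configuration `(ρ, ϑ) → (0, π)` at loop level `0`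
  have step2 : |deriv (fun t : ℝ => frameLevel μ K (levelPoint μ K 0 (φ + θ + t) - pairDiffPath μ K ρ ϑ θ t)) 0 -
      deriv (fun t : ℝ => frameLevel μ K (levelPoint μ K 0 (φ + θ + t) - pairDiffPath μ K 0 π θ t)) 0| ≤
      K₂ * (|ρ| / dd + msD A₃ A₄ 1 * |ϑ - π|) * (3 * msD A₃ A₄ 1) + K₁ * (radialRowOneConst A dd * |ρ| + msD A₃ A₄ 2 * |ϑ - π|) := by
    have hSd : HasDerivAt (pairSumPath μ K ρ ϑ θ) (iteratedDeriv 1 (levelPoint μ K 0) θ + iteratedDeriv 1 (levelPoint μ K ρ) (ϑ + θ)) 0 :=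
      hasDerivAt_pairSumPath_zero hA hd hr hlo hhi hρ ϑ θ
    have hfun : (fun t : ℝ => frameLevel μ K (levelPoint μ K 0 (φ + θ + t) - pairDiffPath μ K ρ ϑ θ t)) = fun t : ℝ =>
        frameLevel μ K ((fun s : ℝ => levelPoint μ K 0 (φ + θ + s) - pairDiffPath μ K 0 π θ s) t + pairSumPath μ K ρ ϑ θ t) := by
      funext t; beta_reduce; rw [← pairDiffPath_pi_sub_eq_pairSumPath]; congr 1; abel
    rw [hfun]
    refine (abs_deriv_comp_add_sub_le hf2 hK₁ hK₂ (hXdiff h0 h0 π) hSd.differentiableAt).trans ?_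
    have hΔ0 : ‖pairSumPath μ K ρ ϑ θ 0‖ ≤ |ρ| / dd + msD A₃ A₄ 1 * |ϑ - π| := norm_pairSumPath_zero_le hA hA20 hd hr hlo hhi hA₃ hA₄ hρ ϑ θ
    have hΔ1 : ‖deriv (pairSumPath μ K ρ ϑ θ) 0‖ ≤ radialRowOneConst A dd * |ρ| + msD A₃ A₄ 2 * |ϑ - π| := by
      rw [← iteratedDeriv_one]; exact norm_deriv_pairSumPath_le_rigid hA hA20 hd hr hlo hhi hA₃ hA₄ hρ ϑ θ
    have hX1 := hXd h0 h0 π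
    have hP0 : 0 ≤ K₂ * (|ρ| / dd + msD A₃ A₄ 1 * |ϑ - π|) :=
      mul_nonneg hK₂0 (add_nonneg (div_nonneg (abs_nonneg ρ) hdpos.le) (mul_nonneg hD₁0 (abs_nonneg _)))
    gcongr
  -- STEP 3: the core at the `2k_F` configuration with the loop on the Fermi curve (`e_K` even)
  have step3 : |deriv (fun t : ℝ => frameLevel μ K (levelPoint μ K 0 (φ + θ + t) - pairDiffPath μ K 0 π θ t)) 0| ≤
      (K₃ * msD A₃ A₄ 1 ^ 2 * (msD A₃ A₄ 1 + |φ| * msD A₃ A₄ 2) + K₂ * msD A₃ A₄ 2 * (3 * msD A₃ A₄ 1 + |φ| * msD A₃ A₄ 2) + K₁ * msD A₃ A₄ 3) * φ ^ 2 := by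
    have hfun : (fun t : ℝ => frameLevel μ K (levelPoint μ K 0 (φ + θ + t) - pairDiffPath μ K 0 π θ t)) = fun t : ℝ =>
        frameLevel μ K (levelPoint μ K 0 (θ + t) + levelPoint μ K 0 (θ + t) - levelPoint μ K 0 (φ + θ + t)) := by
      funext t
      rw [pairDiffPath_tangency, show levelPoint μ K 0 (φ + θ + t) - (levelPoint μ K 0 (θ + t) + levelPoint μ K 0 (θ + t)) =
        -(levelPoint μ K 0 (θ + t) + levelPoint μ K 0 (θ + t) - levelPoint μ K 0 (φ + θ + t)) by abel, frameLevel_neg]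
    rw [hfun]
    exact abs_deriv_tangency_core_le hf hK₁ hK₂ hK₃ (hC h0) (fun s => frameLevel_levelPoint_zero B₀ hA hr hlo hhi s)
      (fun s => hD h0 le_rfl (by norm_num) s) (fun s => hD h0 (by norm_num) (by norm_num) s) (fun s => hD h0 (by norm_num) (by norm_num) s) θ φ
  -- assemble
  have tri := abs_sub_abs_le_abs_sub (deriv (fun t : ℝ => frameLevel μ K (levelPoint μ K e (φ + θ + t) - pairDiffPath μ K ρ ϑ θ t)) 0)
    (deriv (fun t : ℝ => frameLevel μ K (levelPoint μ K 0 (φ + θ + t) - pairDiffPath μ K ρ ϑ θ t)) 0)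
  have tri' := abs_sub_abs_le_abs_sub (deriv (fun t : ℝ => frameLevel μ K (levelPoint μ K 0 (φ + θ + t) - pairDiffPath μ K ρ ϑ θ t)) 0)
    (deriv (fun t : ℝ => frameLevel μ K (levelPoint μ K 0 (φ + θ + t) - pairDiffPath μ K 0 π θ t)) 0)
  have e₁ : K₂ * (|e| / dd) * (3 * msD A₃ A₄ 1) + K₁ * (radialRowOneConst A dd * |e|) = (3 * K₂ * msD A₃ A₄ 1 / dd + K₁ * radialRowOneConst A dd) * |e| := by
    ring
  have e₂ : K₂ * (|ρ| / dd + msD A₃ A₄ 1 * |ϑ - π|) * (3 * msD A₃ A₄ 1) + K₁ * (radialRowOneConst A dd * |ρ| + msD A₃ A₄ 2 * |ϑ - π|) =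
      (3 * K₂ * msD A₃ A₄ 1 / dd + K₁ * radialRowOneConst A dd) * |ρ| + (3 * K₂ * msD A₃ A₄ 1 ^ 2 + K₁ * msD A₃ A₄ 2) * |ϑ - π| := by
    ring
  rw [e₁] at step1
  rw [e₂] at step2
  linarith

end Sizes

end Summit.HubbardSuperconductivity.HubbardSuperconductivity.Theorems.C4a

end
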